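import Summits.PneNP.PneNP.Theorems.PeaThreeNotInP.Negative.ConstantFunctionTest
import Summits.PneNP.PneNP.Theorems.PeaThreeNotInP.Negative.PEAOneMemPromiseP
import Literature.Computability.Complexity.PolynomialEntropyApproximationDegOne
import Literature.Computability.Complexity.CodeFPArith
import Literature.Computability.Complexity.LengthCompare
import Literature.Computability.Complexity.PEAToPED

/-!
# PneNP / SzkEntropy — crux `PeaThreeNotInP` (stmt-PneNP-10776), negative side, II: the threshold-`0` slice is in `P` at every degree

Route `PneNP/SzkEntropy`, crux X = `PeaThreeNotInP` (`PEA 3 ∉ PromiseP`: no polynomial-time language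
separates the sparse cubic maps over `F₂` with `H(p(U_n)) ≥ k + 1` from those with `H ≤ k`).
NEGATIVE LEMMA (a natural restriction of X that is FALSE; no Theses decl is asserted):

* **`thresholdZero_slice_separated`** — for EVERY degree bound `d`, the slice `k = 0` of `PEA d`
  (yes: `H(p(U_n)) ≥ 1`; no: `H(p(U_n)) ≤ 0`, i.e. `p` constant on `F₂ⁿ`) is separated by a
  language in `P`.  So the hardness asserted by X is QUANTITATIVE (thresholds `k ≥ 1`, i.e.
  approximate counting of fibres), not the detection of any output randomness at all; in
  particular the single-output slice `m = 1` (whose only possible yes-threshold is `k = 0`) carries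
  no hardness either.
* `singleOutput_slice_separated` — corollary: the slice `m ≤ 1` (one output polynomial) of
  `PEA d` is in promise-`P` for every `d` (`H ≤ m`, so yes needs `k = 0`).
* The separator is the constant-function test of `ConstantFunctionTest.lean` (`sum_prod_const_iff`,
  `eval_const_iff`), run in polynomial time inside the tree's machine model: the typed `CodeFP`
  certificate `codeFP_tzDecide` of the inline procedure "accept `(n, P, k)` iff `k = 0` and some
  output polynomial has a non-empty support class of odd size" (support comparison by mutual
  membership, class sizes by a counting fold, parity by `natMod`; the context-free `all₀` of
  `PEAOneMemPromiseP.lean` is reused), and its correctness on typed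
  instances (`constTest_untyped_iff`).

References: R. O'Donnell, *Analysis of Boolean Functions*, CUP 2014, §6.2; Z. Dvir, D. Gutfreund,
G. N. Rothblum, S. Vadhan, *On approximating the entropy of polynomial mappings*, ICS 2011 (ECCC
TR10-160), §3 p. 6, Claim 2.2; S. Arora, B. Barak, *Computational Complexity*, CUP 2009, §1.3,
Def. 1.13; O. Goldreich, *On promise problems* (2006), Def. 1.2.
-/

namespace Summit.PneNP.PneNP.Theorems.PeaThreeNotInP.Negative

set_option linter.dupNamespace false -- `Summit.PneNP.PneNP.…`: summit = sub-problem name (D-0017 single-conjunct layout)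

open Literature.Computability.Complexity Literature.InformationTheory.Entropy _root_.Computability
open CodeFP

variable {n : ℕ}

/-! ### The threshold-`0` procedure on untyped instances and its `CodeFP` certificate

The procedure reads the untyped presentation `(n, P, k)` (`PEAInst.untypedCode`): accept iff `k = 0`
and the map FAILS the constant-function test; the test: every output polynomial `p` has, for each
of its non-empty monomials `μ`, an even number of monomials `ν` with the same support
(`(ν.all (· ∈ μ)) && (μ.all (· ∈ ν))`).  Written with inline lambdas (no new definitions). -/

/-- Generic counting fold. [folklore] -/
theorem foldl_ite_succ_eq_countP {α : Type} (q : α → Bool) (l : List α) (k₀ : ℕ) :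
    l.foldl (fun k a => if q a then k + 1 else k) k₀ = k₀ + l.countP q := by
  induction l generalizing k₀ with
  | nil => simp
  | cons a l ih =>
    rw [List.foldl_cons, ih, List.countP_cons]
    cases q a <;> simp; omega


/-- Support comparison `(μ, ν) ↦ ν.all (· ∈ μ)` on codes. [AroraBarak2009, §1.3] -/
theorem codeFP_allMem :
    CodeFP (pairE (rawE natE) (rawE natE)) bitE (fun q => q.2.all fun a => decide (a ∈ q.1)) :=
  all ((mem natE_injective).comp ((snd _ _).pair (fst _ _)))

/-- Same-support test `(ν, μ) ↦ (ν.all (· ∈ μ)) && (μ.all (· ∈ ν))` on codes. [AroraBarak2009, §1.3] -/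
theorem codeFP_same :
    CodeFP (pairE (rawE natE) (rawE natE)) bitE
      (fun q => (q.1.all fun a => decide (a ∈ q.2)) && (q.2.all fun a => decide (a ∈ q.1))) :=
  (codeFP_allMem.comp ((snd _ _).pair (fst _ _))).and codeFP_allMem

/-- Class size `(μ, p) ↦ #{ν ∈ p : same support as μ}` on codes (a fold with a counter).
[AroraBarak2009, §1.3] -/
theorem codeFP_classCount :
    CodeFP (pairE (rawE natE) (rawE (rawE natE))) natE
      (fun q => q.2.countP fun ν =>
        (ν.all fun a => decide (a ∈ q.1)) && (q.1.all fun a => decide (a ∈ ν))) := by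
  have hcond : CodeFP (pairE (rawE natE) (pairE (rawE natE) natE)) bitE
      (fun t => (t.2.1.all fun a => decide (a ∈ t.1)) && (t.1.all fun a => decide (a ∈ t.2.1))) :=
    codeFP_same.comp ((snd _ _).fst'.pair (fst _ _))
  have hacc : CodeFP (pairE (rawE natE) (pairE (rawE natE) natE)) natE (fun t => t.2.2) := (snd _ _).snd'
  have hstep : CodeFP (pairE (rawE natE) (pairE (rawE natE) natE)) natE
      (fun t => if (t.2.1.all fun a => decide (a ∈ t.1)) && (t.1.all fun a => decide (a ∈ t.2.1))
        then t.2.2 + 1 else t.2.2) :=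
    hcond.ite (natAdd.comp (hacc.pair (const _ 1))) hacc
  have h := foldl (σ := List ℕ) (α := List ℕ) (β := ℕ) (eσ := rawE natE) (eα := rawE natE) (eβ := natE)
    (step := fun μ ν k =>
      if (ν.all fun a => decide (a ∈ μ)) && (μ.all fun a => decide (a ∈ ν)) then k + 1 else k)
    (init := fun _ => 0) hstep (const _ 0) Polynomial.X (fun μ l₁ l₂ => by
      rw [foldl_ite_succ_eq_countP, Nat.zero_add, Polynomial.eval_X, pairE_apply, length_boolPair]
      calc (natE (l₁.countP _)).length ≤ l₁.countP _ := length_natE_le _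
        _ ≤ l₁.length := List.countP_le_length
        _ ≤ (l₁ ++ l₂).length := by simp
        _ ≤ (rawE (rawE natE) (l₁ ++ l₂)).length := length_le_length_rawE _ _
        _ ≤ _ := by dsimp only; omega)
  exact h.congr fun q => by rw [foldl_ite_succ_eq_countP, Nat.zero_add]

/-- The per-polynomial constant test
`p ↦ p.all (fun μ => μ.isEmpty || (class size of μ in p) % 2 = 0)` on codes. [AroraBarak2009, §1.3] -/
theorem codeFP_constPoly :
    CodeFP (rawE (rawE natE)) bitE (fun p : List (List ℕ) => p.all fun μ =>
      μ.isEmpty || decide ((p.countP fun ν =>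
        (ν.all fun a => decide (a ∈ μ)) && (μ.all fun a => decide (a ∈ ν))) % 2 = 0)) := by
  have hempty : CodeFP (pairE (rawE (rawE natE)) (rawE natE)) bitE (fun q => q.2.isEmpty) :=
    (rawIsEmpty natE).comp (snd _ _)
  have hcnt : CodeFP (pairE (rawE (rawE natE)) (rawE natE)) natE
      (fun q => q.1.countP fun ν =>
        (ν.all fun a => decide (a ∈ q.2)) && (q.2.all fun a => decide (a ∈ ν))) :=
    codeFP_classCount.comp ((snd _ _).pair (fst _ _))
  have heven : CodeFP (pairE (rawE (rawE natE)) (rawE natE)) bitE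
      (fun q => decide ((q.1.countP fun ν =>
        (ν.all fun a => decide (a ∈ q.2)) && (q.2.all fun a => decide (a ∈ ν))) % 2 = 0)) :=
    natEq.comp ((natMod.comp (hcnt.pair (const _ 2))).pair (const _ 0))
  exact ((all (hempty.or heven)).comp ((CodeFP.id _).pair (CodeFP.id _))).congr fun _ => rfl

/-- **The threshold-`0` procedure is computed on instance codes by a polynomial-time string
function**: accept `(n, P, k)` iff `k = 0` and some output polynomial fails the constant test.
[AroraBarak2009, §1.3] -/
theorem codeFP_tzDecide :
    CodeFP PEAInst.untypedCode bitE (fun t : ℕ × (List (List (List ℕ)) × ℕ) =>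
      decide (t.2.2 = 0) && !(t.2.1.all fun p => p.all fun μ =>
        μ.isEmpty || decide ((p.countP fun ν =>
          (ν.all fun a => decide (a ∈ μ)) && (μ.all fun a => decide (a ∈ ν))) % 2 = 0))) := by
  have h1 : CodeFP (listE (listE (listE natE))) (rawE (listE (listE natE))) id := rawOfList _
  have h2 : CodeFP (rawE (listE (listE natE))) (rawE (rawE (listE natE))) (fun l => l.map id) :=
    map₀ (rawOfList _)
  have h3 : CodeFP (rawE (rawE (listE natE))) (rawE (rawE (rawE natE)))
      (fun l => l.map fun p => p.map id) := map₀ (map₀ (rawOfList _))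
  have hP : CodeFP PEAInst.untypedCode (rawE (rawE (rawE natE))) (fun t => t.2.1) := by
    unfold PEAInst.untypedCode
    exact ((h3.comp (h2.comp h1)).comp (snd _ _).fst').congr fun s => by simp
  have hk : CodeFP PEAInst.untypedCode natE (fun t => t.2.2) := by
    unfold PEAInst.untypedCode
    exact (snd _ _).snd'
  exact ((natEq.comp (hk.pair (const _ 0))).and ((all₀ codeFP_constPoly).comp hP).not).congr fun _ => rfl

/-! ### Correctness on instances and the separated slice -/

/-- On the untyped presentation of a typed polynomial the same-support test is equality of supports. -/
theorem same_map_val_iff (ν μ : List (Fin n)) :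
    (((ν.map Fin.val).all fun a => decide (a ∈ μ.map Fin.val)) &&
        ((μ.map Fin.val).all fun a => decide (a ∈ ν.map Fin.val))) = true ↔
      ν.toFinset = μ.toFinset := by
  have key : ∀ (l l' : List (Fin n)), ((l.map Fin.val).all fun a => decide (a ∈ l'.map Fin.val)) = true ↔
      l.toFinset ⊆ l'.toFinset := by
    intro l l'
    simp only [List.all_map, List.all_eq_true, Function.comp_apply, decide_eq_true_eq, List.mem_map]
    constructor
    · intro h c hc
      rw [List.mem_toFinset] at hc ⊢
      obtain ⟨b, hb, hbc⟩ := h c hc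
      rwa [← Fin.val_injective hbc]
    · intro h c hc
      exact ⟨c, List.mem_toFinset.1 (h (List.mem_toFinset.2 hc)), rfl⟩
  rw [Bool.and_eq_true, key, key]
  exact ⟨fun h => Finset.Subset.antisymm h.1 h.2, fun h => ⟨h.le, h.ge⟩⟩

/-- Class sizes agree between the untyped and the typed presentation. -/
theorem countP_map_val (p : List (List (Fin n))) (μ : List (Fin n)) :
    ((p.map (List.map Fin.val)).countP fun ν =>
        (ν.all fun a => decide (a ∈ μ.map Fin.val)) && ((μ.map Fin.val).all fun a => decide (a ∈ ν))) =
      p.countP fun ν => decide (ν.toFinset = μ.toFinset) := by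
  rw [List.countP_map]
  refine List.countP_congr fun ν _ => ?_
  simp only [Function.comp_apply]
  rw [same_map_val_iff, decide_eq_true_iff]

/-- **The constant test is correct**: on the untyped presentation of `P : PolyMapF2 n` it answers
`true` iff `P` is constant on `F₂ⁿ`. [O'Donnell 2014, §6.2] -/
theorem constTest_untyped_iff (P : PolyMapF2 n) :
    ((P.map (List.map (List.map Fin.val))).all fun p => p.all fun μ =>
        μ.isEmpty || decide ((p.countP fun ν =>
          (ν.all fun a => decide (a ∈ μ)) && (μ.all fun a => decide (a ∈ ν))) % 2 = 0)) = true ↔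
      ∀ x y : Fin n → ZMod 2, P.eval x = P.eval y := by
  rw [eval_const_iff, List.all_map, List.all_eq_true]
  simp only [Function.comp_apply]
  refine forall₂_congr fun p _ => ?_
  rw [List.all_map, List.all_eq_true]
  simp only [Function.comp_apply]
  refine forall₂_congr fun μ _ => ?_
  rw [Bool.or_eq_true, List.isEmpty_iff, List.map_eq_nil_iff, decide_eq_true_iff, countP_map_val]
  constructor
  · intro h hne
    exact h.resolve_left hne
  · intro h
    by_cases hμ : μ = []
    · exact Or.inl hμ
    · exact Or.inr (h hμ)

/-- **The threshold-`0` slice of `PEA d` is in promise-`P`, for every degree `d`.**  Some language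
of `P` contains every yes-instance `(n, P, 0)` (`H(P(U_n)) ≥ 1`) and no no-instance `(n, P, 0)`
(`H(P(U_n)) ≤ 0`): the constant-function test.  Hence thesis X restricted to the threshold `k = 0`
(or to single-output maps) is false; the hardness X asserts needs `k ≥ 1`.
[DvirGutfreundRothblumVadhan2010, §3 p. 6; Goldreich2006, Def. 1.2; O'Donnell 2014, §6.2] -/
theorem thresholdZero_slice_separated (d : ℕ) :
    ∃ L ∈ Classes.P,
      PEAInst.encoding.toLanguage
          {I | (I.2.1.DegLE d ∧ (I.2.2 : ℝ) + 1 ≤ I.2.1.entropy) ∧ I.2.2 = 0} ≤ L ∧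
      PEAInst.encoding.toLanguage
          {I | (I.2.1.DegLE d ∧ I.2.1.entropy ≤ (I.2.2 : ℝ)) ∧ I.2.2 = 0} ≤ Lᶜ ∧
      PEAInst.encoding.toLanguage {I | I.2.2 ≠ 0} ≤ Lᶜ := by
  classical
  obtain ⟨f₀, hf₀, hspec⟩ := codeFP_tzDecide
  set g : List Bool → List Bool := HashBricks.headBitFn ∘ f₀ with hg
  have hgFP : g ∈ FP := comp_mem_FP HashBricks.headBitFn_mem_FP hf₀
  have hval : ∀ I : PEAInst, g (PEAInst.encoding.encode I) =
      [decide (I.2.2 = 0) && !((I.2.1.map (List.map (List.map Fin.val))).all fun p => p.all fun μ =>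
        μ.isEmpty || decide ((p.countP fun ν =>
          (ν.all fun a => decide (a ∈ μ)) && (μ.all fun a => decide (a ∈ ν))) % 2 = 0))] := by
    intro I
    rw [hg, Function.comp_apply, PEAInst.encode_eq_untypedCode, hspec, HashBricks.headBitFn_apply]
    rfl
  set L : Language Bool := {w | g w = [true]} with hLdef
  have hL : L ∈ Classes.P := by
    refine mem_P_of_mem_FP hgFP L fun w => ⟨fun hw => hw, fun hw => ?_⟩
    have hw' : g w ≠ [true] := hw
    have hone : g w = [(f₀ w).headD false] := by
      rw [hg, Function.comp_apply, HashBricks.headBitFn_apply]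
    rw [hone] at hw' ⊢
    cases hb : (f₀ w).headD false
    · rfl
    · rw [hb] at hw'
      exact absurd rfl hw'
  refine ⟨L, hL, ?_, ?_, ?_⟩
  · -- yes-instances at threshold 0 are non-constant maps: the test fails, the procedure accepts
    rintro w ⟨I, ⟨⟨-, hH⟩, hk⟩, rfl⟩
    have htest : ((I.2.1.map (List.map (List.map Fin.val))).all fun p => p.all fun μ =>
        μ.isEmpty || decide ((p.countP fun ν =>
          (ν.all fun a => decide (a ∈ μ)) && (μ.all fun a => decide (a ∈ ν))) % 2 = 0)) = false := by
      rw [Bool.eq_false_iff, Ne, constTest_untyped_iff]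
      intro hconst
      rw [entropy_eq_zero_of_eval_const hconst, hk, Nat.cast_zero] at hH
      norm_num at hH
    show g (PEAInst.encoding.encode I) = [true]
    rw [hval, htest, hk]
    decide
  · -- no-instances at threshold 0 are constant maps: the test passes, the procedure rejects
    rintro w ⟨I, ⟨⟨-, hH⟩, hk⟩, rfl⟩ hw
    change g (PEAInst.encoding.encode I) = [true] at hw
    rw [hval] at hw
    have htest : ((I.2.1.map (List.map (List.map Fin.val))).all fun p => p.all fun μ =>
        μ.isEmpty || decide ((p.countP fun ν =>
          (ν.all fun a => decide (a ∈ μ)) && (μ.all fun a => decide (a ∈ ν))) % 2 = 0)) = true := by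
      rw [constTest_untyped_iff]
      rw [hk, Nat.cast_zero] at hH
      exact eval_const_of_entropy_le_zero hH
    rw [htest] at hw
    simp at hw
  · -- instances with a positive threshold are rejected outright
    rintro w ⟨I, hk, rfl⟩ hw
    change g (PEAInst.encoding.encode I) = [true] at hw
    rw [hval] at hw
    have hk' : decide (I.2.2 = 0) = false := decide_eq_false hk
    rw [hk'] at hw
    simp at hw

/-- **The single-output slice of `PEA d` is in promise-`P`, for every degree `d`.**  With `m ≤ 1`
output polynomial `H ≤ m ≤ 1`, so a yes-instance has `k = 0`; the threshold-`0` separator (which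
rejects every `k ≠ 0`) separates the slice.  One cubic form, however intricate, carries no hardness
for X. [DvirGutfreundRothblumVadhan2010, §3 p. 6; Goldreich2006, Def. 1.2] -/
theorem singleOutput_slice_separated (d : ℕ) :
    ∃ L ∈ Classes.P,
      PEAInst.encoding.toLanguage
          {I | (I.2.1.DegLE d ∧ (I.2.2 : ℝ) + 1 ≤ I.2.1.entropy) ∧ I.2.1.length ≤ 1} ≤ L ∧
      PEAInst.encoding.toLanguage
          {I | (I.2.1.DegLE d ∧ I.2.1.entropy ≤ (I.2.2 : ℝ)) ∧ I.2.1.length ≤ 1} ≤ Lᶜ := by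
  obtain ⟨L, hL, hyes, hno, hpos⟩ := thresholdZero_slice_separated d
  refine ⟨L, hL, ?_, ?_⟩
  · rintro w ⟨I, ⟨hI, hm⟩, rfl⟩
    have hk : I.2.2 = 0 := by
      have h1 := hI.2.trans (PolyMapF2.entropy_le_length I.2.1)
      have h2 : ((I.2.2 : ℕ) : ℝ) + 1 ≤ (1 : ℕ) := h1.trans (by exact_mod_cast hm)
      have h3 : I.2.2 + 1 ≤ 1 := by exact_mod_cast h2
      omega
    exact hyes ⟨I, ⟨hI, hk⟩, rfl⟩
  · rintro w ⟨I, ⟨hI, -⟩, rfl⟩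
    by_cases hk : I.2.2 = 0
    · exact hno ⟨I, ⟨hI, hk⟩, rfl⟩
    · exact hpos ⟨I, hk, rfl⟩

end Summit.PneNP.PneNP.Theorems.PeaThreeNotInP.Negative
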